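import Summits.CriticalPhenomena.PercolationContinuityZ3.Theorems.Transplant.TwoAxisParaCellsFineFrame
import Summits.CriticalPhenomena.PercolationContinuityZ3.Theorems.Transplant.SkelPhiSideForm
import HarnessLib

/-!
# N1 ({±1} node), kit adapter (hp-8 g33 for p1-g11's apron kit, note (i) of the design owner 2026-08-21 14:57Z): the SIDE FORMS OF AN EXIT FRAME —
# every side of a `ψ`-box of `Skelφ.exitFrame φ t I b cα cβ U s` is a sharp half-plane of the base chart `φ`: the two LEVEL sides (`ψ·I = ⌊(L(φ − φt) + s)/U⌋`)
# are the half-planes `±L(φ ·) ≥ θ`, the two RAW sides (`ψ·(oth I) = φ_b − φt_b`) are `±φ_b ≥ θ`; packaged as p1-g11's `Skelφ.SideForm` for all four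
# sides at once (`sideForms_exitFrame`, the `SF` argument of `kitOK_apronA`), and for the (F) face frame `FinePrm.frame` (`FinePrm.sideForms_frame`,
# climbing axis = the inward axis `oth b`)

builds on p205010 (kernel theorem, internal audit signed; external expert review pending) — nothing in this file uses p205010; planar arithmetic only.
Lane `prim-bschramm`, seat `prim-hp-8` (gen 33); helper file (`--supports stmt-CriticalPhenomena-4575 --as helper`).
* §1 `linForm_sub'`, `linForm_neg_coef`, `linForm_unit`; the four sides `sideFormLvLo` (`(I, −1)`: form `(cα, cβ)`, `θ m = U(Lo I + m) + L(φt) − s`),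
  `sideFormLvHi` (`(I, 1)`: form `(−cα, −cβ)`, `θ m = s − L(φt) − U(Hi I − m + 1) + 1`), `sideFormRawLo` (`(oth I, −1)`: form `e_b`, `θ m = Lo (oth I) + m + φt_b`),
  `sideFormRawHi` (`(oth I, 1)`: form `−e_b`, `θ m = m − Hi (oth I) − φt_b`); **`sideForms_exitFrame`** (all four; level sides climb along a given axis `a`
  with `0 < sg·coef cα cβ a`, raw sides along `b`);
* §2 **`FinePrm.sideForms_frame`** (the face frame `pr.frame φ t I b`: level form `c_I·λ_I`, climbing axis `oth b`, `0 < c_I`, `A ≠ 0`, `lvGen I b ≠ 0`).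
[cite: KozmaNitzan2024, §4 Lemma 10, p. 21 ("Q ⊆ S")] [cite: MartineauTassion2017, §4.3]
-/

noncomputable section

open scoped Classical

namespace Summit.CriticalPhenomena.PercolationContinuityZ3.Theorems.Transplant

namespace Skelφ

open Literature.Probability.LatticeModels
open Literature.Probability.Percolation.KozmaNitzan.Cells (oth oth_ne eq_oth_of_ne oth_oth)
open TwoAxis.Para (coarse)

variable {V : Type} {φ : V → Site 2}

/-! ## §1 The four sides of a box of an exit frame -/

/-- `L` is additive: `L(x) − L(y) = L(x − y)`. [folklore] -/
theorem linForm_sub' (cα cβ : ℤ) (x y : Site 2) : linForm cα cβ (x - y) = linForm cα cβ x - linForm cα cβ y := by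
  simp only [linForm, Pi.sub_apply]; ring

/-- The negated form. [folklore] -/
theorem linForm_neg_coef (cα cβ : ℤ) (x : Site 2) : linForm (-cα) (-cβ) x = -linForm cα cβ x := by
  simp only [linForm]; ring

/-- The unit form `e_b` reads coordinate `b`: `linForm (coef 1 0 b?) …` — concretely `L_{e_b}(x) = x b`. [folklore] -/
theorem linForm_unit (b : Fin 2) (x : Site 2) : linForm (if b = 0 then 1 else 0) (if b = 0 then 0 else 1) x = x b := by
  obtain rfl | rfl : b = 0 ∨ b = 1 := by fin_cases b <;> simp
  · simp [linForm]
  · simp [linForm]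

/-- The coefficient of the unit form `e_b` on axis `b` is `1`. [folklore] -/
theorem coef_unit (b : Fin 2) : coef (if b = 0 then (1 : ℤ) else 0) (if b = 0 then 0 else 1) b = 1 := by
  obtain rfl | rfl : b = 0 ∨ b = 1 := by fin_cases b <;> simp
  · simp [coef]
  · simp [coef]

/-- The coefficients of the negated form. [folklore] -/
theorem coef_neg (cα cβ : ℤ) (a : Fin 2) : coef (-cα) (-cβ) a = -coef cα cβ a := by
  unfold coef; split_ifs <;> rfl

section Sides

variable (φ) (t : V) (I b : Fin 2) (cα cβ U s : ℤ) (hU : 0 < U) (a : Fin 2) (sg : ℤˣ) (hclim : 0 < (sg : ℤ) * coef cα cβ a) (Lo Hi : Site 2)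

/-- The level coordinate of the exit frame, unfolded: `ψ w I = ⌊(L(φ w) − L(φ t) + s)/U⌋`. [folklore] -/
theorem exitFrame_lv_eq (w : V) : exitFrame φ t I b cα cβ U s w I = (linForm cα cβ (φ w) - linForm cα cβ (φ t) + s) / U := by
  rw [exitFrame_apply_self]
  have hrel : relφ φ t w = φ w - φ t := by funext i; simp [relφ]
  unfold TwoAxis.Para.coarse; rw [one_mul, hrel, linForm_sub']

/-- The raw coordinate of the exit frame, unfolded: `ψ w (oth I) = φ w b − φ t b`. [folklore] -/
theorem exitFrame_raw_eq (w : V) : exitFrame φ t I b cα cβ U s w (oth I) = φ w b - φ t b := by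
  rw [exitFrame_apply_oth]; simp [relφ]

include hU in
/-- **The lower level side** `(I, −1)`: depth `≥ m` iff `L(φ v) ≥ U·(Lo I + m) + L(φ t) − s`. [this work] -/
def sideFormLvLo : SideForm (exitFrame φ t I b cα cβ U s) φ Lo Hi I (-1) where
  cα := cα
  cβ := cβ
  θ := fun m => U * (Lo I + m) + linForm cα cβ (φ t) - s
  a := a
  s := sg
  clim := hclim
  depth_iff := fun v m => by
    have hne : ((-1 : ℤˣ) : ℤ) ≠ 1 := by decide
    simp only [sdepth, if_neg hne]
    rw [exitFrame_lv_eq]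
    constructor
    · intro h
      have h1 : Lo I + m ≤ (linForm cα cβ (φ v) - linForm cα cβ (φ t) + s) / U := by linarith
      rw [Int.le_ediv_iff_mul_le hU] at h1; linarith
    · intro h
      have h1 : Lo I + m ≤ (linForm cα cβ (φ v) - linForm cα cβ (φ t) + s) / U := by
        rw [Int.le_ediv_iff_mul_le hU]; linarith
      linarith

include hU in
/-- **The upper level side** `(I, 1)`: depth `≥ m` iff `−L(φ v) ≥ s − L(φ t) − U·(Hi I − m + 1) + 1`. [this work] -/
def sideFormLvHi : SideForm (exitFrame φ t I b cα cβ U s) φ Lo Hi I 1 where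
  cα := -cα
  cβ := -cβ
  θ := fun m => s - linForm cα cβ (φ t) - U * (Hi I - m + 1) + 1
  a := a
  s := -sg
  clim := by rw [coef_neg, Units.val_neg]; linarith
  depth_iff := fun v m => by
    simp only [sdepth, Units.val_one, if_true]
    rw [exitFrame_lv_eq, linForm_neg_coef]
    constructor
    · intro h
      have h1 : (linForm cα cβ (φ v) - linForm cα cβ (φ t) + s) / U < Hi I - m + 1 := by linarith
      rw [Int.ediv_lt_iff_lt_mul hU] at h1; linarith
    · intro h
      have h1 : (linForm cα cβ (φ v) - linForm cα cβ (φ t) + s) / U < Hi I - m + 1 := by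
        rw [Int.ediv_lt_iff_lt_mul hU]; linarith
      linarith

/-- **The lower raw side** `(oth I, −1)`: depth `≥ m` iff `φ_b(v) ≥ Lo (oth I) + m + φ_b(t)`. [this work] -/
def sideFormRawLo : SideForm (exitFrame φ t I b cα cβ U s) φ Lo Hi (oth I) (-1) where
  cα := if b = 0 then 1 else 0
  cβ := if b = 0 then 0 else 1
  θ := fun m => Lo (oth I) + m + φ t b
  a := b
  s := 1
  clim := by rw [coef_unit, Units.val_one]; norm_num
  depth_iff := fun v m => by
    have hne : ((-1 : ℤˣ) : ℤ) ≠ 1 := by decide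
    simp only [sdepth, if_neg hne]
    rw [exitFrame_raw_eq, linForm_unit]
    constructor <;> intro h <;> linarith

/-- **The upper raw side** `(oth I, 1)`: depth `≥ m` iff `−φ_b(v) ≥ m − Hi (oth I) − φ_b(t)`. [this work] -/
def sideFormRawHi : SideForm (exitFrame φ t I b cα cβ U s) φ Lo Hi (oth I) 1 where
  cα := -(if b = 0 then 1 else 0)
  cβ := -(if b = 0 then 0 else 1)
  θ := fun m => m - Hi (oth I) - φ t b
  a := b
  s := -1
  clim := by rw [coef_neg, coef_unit]; norm_num
  depth_iff := fun v m => by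
    simp only [sdepth, Units.val_one, if_true]
    rw [exitFrame_raw_eq, linForm_neg_coef, linForm_unit]
    constructor <;> intro h <;> linarith

include hU in
/-- **ALL FOUR SIDES of a box of an exit frame are sharp half-planes of the base chart** — the `SF` argument of p1-g11's `kitOK_apronA`, for every box
`Icc Lo Hi` (level sides climb along the axis `a`, raw sides along `b`). [cite: KozmaNitzan2024, §4 Lemma 10, p. 21] -/
def sideForms_exitFrame : ∀ (i : Fin 2) (σ : ℤˣ), SideForm (exitFrame φ t I b cα cβ U s) φ Lo Hi i σ := fun i σ => by
  by_cases hi : i = I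
  · subst hi
    by_cases hσ : σ = 1
    · subst hσ; exact sideFormLvHi φ t i b cα cβ U s hU a sg hclim Lo Hi
    · have hσ' : σ = -1 := (Int.units_eq_one_or σ).resolve_left hσ
      subst hσ'; exact sideFormLvLo φ t i b cα cβ U s hU a sg hclim Lo Hi
  · have hi' : i = oth I := eq_oth_of_ne hi
    subst hi'
    by_cases hσ : σ = 1
    · subst hσ; exact sideFormRawHi φ t I b cα cβ U s Lo Hi
    · have hσ' : σ = -1 := (Int.units_eq_one_or σ).resolve_left hσ
      subst hσ'; exact sideFormRawLo φ t I b cα cβ U s Lo Hi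

end Sides

/-! ## §2 The side forms of the (F) face frame -/

namespace FinePrm

variable (pr : FinePrm) (φ) (t : V) (I b : Fin 2)

/-- The inward coefficient of the face frame's level form on the axis `oth b` is `± c_I·A·lvGen I b`, so it is nonzero for `0 < c_I`, `A ≠ 0`,
`lvGen I b ≠ 0`; its sign gives the climbing sign. [folklore] -/
theorem exists_clim (hc : 0 < pr.cOf I) (hA : pr.A ≠ 0) (hnz : pr.lvGen I b ≠ 0) :
    ∃ sg : ℤˣ, (I = 0 → 0 < (sg : ℤ) * coef (pr.c₀ * pr.A * pr.vβ) (-(pr.c₀ * pr.A * pr.vα)) (oth b)) ∧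
      (I = 1 → 0 < (sg : ℤ) * coef (-(pr.c₁ * pr.A * pr.h)) (pr.c₁ * pr.A * pr.n) (oth b)) := by
  -- the relevant coefficient `κ`
  set κ : ℤ := if I = 0 then coef (pr.c₀ * pr.A * pr.vβ) (-(pr.c₀ * pr.A * pr.vα)) (oth b)
    else coef (-(pr.c₁ * pr.A * pr.h)) (pr.c₁ * pr.A * pr.n) (oth b) with hκ
  have hκ0 : κ ≠ 0 := by
    obtain rfl | rfl : I = 0 ∨ I = 1 := by fin_cases I <;> simp
    · rw [cOf_zero] at hc
      obtain rfl | rfl : b = 0 ∨ b = 1 := by fin_cases b <;> simp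
      · rw [lvGen_zero_zero] at hnz
        simp only [hκ, if_true, show oth (0 : Fin 2) = 1 from rfl, coef, show (1 : Fin 2) ≠ 0 by decide, if_false]
        exact neg_ne_zero.2 (mul_ne_zero (mul_ne_zero hc.ne' hA) hnz)
      · rw [lvGen_zero_one] at hnz
        simp only [hκ, if_true, show oth (1 : Fin 2) = 0 from rfl, coef]
        exact mul_ne_zero (mul_ne_zero hc.ne' hA) hnz
    · rw [cOf_one] at hc
      obtain rfl | rfl : b = 0 ∨ b = 1 := by fin_cases b <;> simp
      · rw [lvGen_one_zero] at hnz
        simp only [hκ, show (1 : Fin 2) ≠ 0 by decide, if_false, show oth (0 : Fin 2) = 1 from rfl, coef]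
        exact mul_ne_zero (mul_ne_zero hc.ne' hA) hnz
      · rw [lvGen_one_one] at hnz
        simp only [hκ, show (1 : Fin 2) ≠ 0 by decide, if_false, show oth (1 : Fin 2) = 0 from rfl, coef, if_true]
        exact neg_ne_zero.2 (mul_ne_zero (mul_ne_zero hc.ne' hA) hnz)
  rcases lt_or_gt_of_ne hκ0 with hlt | hgt
  · refine ⟨-1, fun hI => ?_, fun hI => ?_⟩
    · have : κ = coef (pr.c₀ * pr.A * pr.vβ) (-(pr.c₀ * pr.A * pr.vα)) (oth b) := by rw [hκ, if_pos hI]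
      rw [← this, Units.val_neg, Units.val_one]; linarith
    · have : κ = coef (-(pr.c₁ * pr.A * pr.h)) (pr.c₁ * pr.A * pr.n) (oth b) := by
        rw [hκ, if_neg (by rw [hI]; decide)]
      rw [← this, Units.val_neg, Units.val_one]; linarith
  · refine ⟨1, fun hI => ?_, fun hI => ?_⟩
    · have : κ = coef (pr.c₀ * pr.A * pr.vβ) (-(pr.c₀ * pr.A * pr.vα)) (oth b) := by rw [hκ, if_pos hI]
      rw [← this, Units.val_one]; linarith
    · have : κ = coef (-(pr.c₁ * pr.A * pr.h)) (pr.c₁ * pr.A * pr.n) (oth b) := by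
        rw [hκ, if_neg (by rw [hI]; decide)]
      rw [← this, Units.val_one]; linarith

/-- **The side forms of the face frame** `pr.frame φ t I b` for every box `Icc Lo Hi` (level form `c_I·λ_I`, climbing axis `oth b`; raw axis `b`),
under `0 < c_I`, `A ≠ 0`, `lvGen I b ≠ 0`, `0 < D`. [this work] -/
def sideForms_frame (hc : 0 < pr.cOf I) (hA : pr.A ≠ 0) (hnz : pr.lvGen I b ≠ 0) (hD : 0 < pr.D) (Lo Hi : Site 2) :
    ∀ (i : Fin 2) (σ : ℤˣ), SideForm (pr.frame φ t I b) φ Lo Hi i σ := fun i σ => by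
  have h := pr.exists_clim I b hc hA hnz
  by_cases hI : I = 0
  · subst hI
    rw [frame_zero]
    exact sideForms_exitFrame φ t 0 b _ _ pr.D (pr.D / 2) hD (oth b) (Classical.choose h) ((Classical.choose_spec h).1 rfl) Lo Hi i σ
  · have hI' : I = 1 := by obtain rfl | rfl : I = 0 ∨ I = 1 := (by fin_cases I <;> simp); exact absurd rfl hI; rfl
    subst hI'
    rw [frame_one]
    exact sideForms_exitFrame φ t 1 b _ _ pr.D (pr.D / 2) hD (oth b) (Classical.choose h) ((Classical.choose_spec h).2 rfl) Lo Hi i σ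

end FinePrm

end Skelφ

end Summit.CriticalPhenomena.PercolationContinuityZ3.Theorems.Transplant

end
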